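import Literature.MathematicalPhysics.QuantumFieldTheory.Balaban1983to89.B9Cor36GDirKnitEntriesAtCutField
import Literature.MathematicalPhysics.QuantumFieldTheory.Balaban1983to89.B9CubeDirInverseBondCMemberRowsAtRecordY
import Literature.MathematicalPhysics.QuantumFieldTheory.Balaban1983to89.B9Cor36GpDirMemberBlocksAtRecordY

/-!
v1.1 (dag-n06-d g35, LOCATED-37): + ★★★`cubeRowsGDirCY_at_memberU` — the α₀-UNIFORM edition (`∀ α₀ > 0` per member inside the universal block, constants chosen before it;
the original proof moved under it, over ✓`gDir_knit_entries_at_cutFieldU`); `cubeRowsGDirCY_at_member` is re-proved as its corollary, statement unchanged.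

# `Balaban1983to89.B9Cor36GDirKnitRowsAtMemberY` — [Balaban1985BackgroundPropagators] COROLLARY 3.6 p. 408 FOR THE DIRICHLET BOND LETTER OF RECORD AT THE N06 RECORD: dag-n06-d's
# BUNDLE `CubeRowsGDirCY x.toKIdx □ U dB B δ α` (✓`B9CubeDirInverseBondCMemberRowsAtRecordY`) INHABITED at every member above thresholds, every unitary-valued `U` and every
# cover cube `□`, FROM a (3.35) BOND DATUM of `Ω₀(□)` (`DatumBUY`, displayed — LOCATED-32), the bond socket `hKB`, [4] Prop. 2.6 for `G(Ω)` BY NAME, and the flat right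
# half of (3.42)₃ (displayed — cell GAPS G-B9-02) — the heads' row `hRowsA` per `(x, U, □)` modulo exactly these (seat dag-n06-c g34, FILE F6 of road (B5)'s rest)

statement-level skeleton of published theorems with citation tags; proofs where landed; nothing here is a claim about the Yang–Mills mass gap

CITATION HEADER (lean-in-tree rule).  B9 = T. Bałaban, *Propagators for lattice gauge theories in a background field*, Commun. Math. Phys. **99** (1985)
389–434 [Balaban1985BackgroundPropagators] (held `paper:balaban1985-cmp99-background-propagators`; journal page = PDF page + 388): Cor. 3.6 p. 408 l. 1–14 («If a
configuration U satisfies (3.35) … Ω′₀ ⊂ □ for a cube □ of the class described in this condition, then Theorems 3.1-3.3 hold for the operators … constructed for the sequence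
{Ω′_j} … U′ = Uᵘ = e^{iηA} … and we have to recall only that all the results of these theorems are gauge invariant»); (3.35) p. 396; Thm 3.3 p. 399, Thm 3.1 (3.42) p. 397;
p. 409 l. 1–5 («G_□(U)»); p. 410 l. 14–15.  [4] = [Balaban1984PropagatorsII] Lemma 2.1 (2.61) p. 234, (2.51) p. 232, Prop. 2.6 (2.136) p. 247, p. 248 l. 4–5.  Rows B9.Cor3.6 ×
B9.Thm3.3 (cells only; no row head changes).

WHY THIS FILE (cell `pub-ymgap`, node N06 [B9]).  The heads «KE₂₀X-C» ∕ «KESC-CN» display `hRowsA : ∀ x …, ∀ U ∈ Reg335 …, ∀ □, CubeRowsGDirCY x.toKIdx □ U dBA BA δA αA`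
(dag-n06-d g35 ✓p831726∕p831728); dag-n06-d's §4 ✓`cubeRowsGDirCY_of_cutDatum` reduces the bundle at `(x, U, □)` to: a unitary gauge `u`, a potential `A`, a cut set `T` one
layer beyond the pinned reading set `nearAPinCY □ Ω₀(□)`, a box `Q ⊇ chart⁻¹T` with `Uᵘ = e^{iηA}` on its bonds, (2.61) on the cube geometry, `IsUnit padΔ_{loc,□}(Ṽ)` and the
four rows AT `Ṽ := cutCfgS i T η A`.  F5 (✓`gDir_knit_entries_at_cutField`) supplies the unit clause and the rows E0 ∕ E1 ∕ E3 and E2 modulo its flat half; F3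
(✓`unitaryLike_cutCfgS_of_unitary`) the bi-contractivity from unitarity; r05's ✓`exists_h261_geoCK` the (2.61) sum.  THIS FILE bundles the per-cube inputs into ONE displayed
predicate `DatumBUY i □ U a₁ α₀′ ϱ′` (the bond twin of dag-n06-d's ✓`Datum36UY`: the (3.35) datum of a box containing `T ⊇ Ω₀(□) ∪` the one-layer thickening of
`nearAPinCY □ Ω₀(□)`, p06's knit-leg numerics at `α₀′` and `2CΛ²`, `2CΛ² ≤ a₁`, `6CΛ² ≤ ϱ′`) and proves ★★★ `cubeRowsGDirCY_at_member`: for every member above thresholds,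
every unitary-valued `U` with a `DatumBUY` and a bond socket at every cube, the flat right half displayed, `CubeRowsGDirCY x.toKIdx □ U dB B δ (9∕5000)` at every `□` — with
`(dB, B, δ)` and the thresholds uniform (functions of `d, L, N, b₀, b₁, ϱ′` and the knit-engine numerics).  The heads' `hRowsA` then follows per `(x, U)` from three displayed
rows (datum, socket, flat right half) and the named fact — the h36b recipe of ✓`B9Cor36GpDirMemberBlocksAtRecordY`.

WHAT IS PROVED (2 `def`s with bodies — `DatumBWit`, `DatumBUY`; theorems; 0 sorry; 0 new named facts; standard axioms): `DatumBWit`, `DatumBUY`, ★★★`cubeRowsGDirCY_at_member`.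

HONEST SCOPE ∕ NOT CLAIMED.  Assembly BY NAME (F5, F3, dag-n06-d §4, r05 (2.61)); CONDITIONAL BY NAME on `B6.Prop26DirichletPrinted` (`h26`); DISPLAYED: the datum `DatumBUY`
at every cube (LOCATED-32: not supplied by the record's class cubes as such — the cut set must sit inside a (3.35) box), the bond socket `hKB` (invertibility of the compression
of `mDirC i □` to `bondsOverY Ω₀(□)`, [4] (2.21)–(2.22)), the flat right half `hR` of (3.42)₃ at the cut field (cell GAPS G-B9-02), the knit-engine numerics, member
thresholds, `U` unitary-valued (the record's `Reg335` class).  Nothing on `d = 4`, the continuum, reflection positivity or the mass gap; NOT a node discharge; count-neutral;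
no row head changes.  NEW file; nothing landed is modified.  `--supports stmt-QuantumFields-27239`.

RELATED IN THE TREE, NOT DUPLICATED (searched 2026-08-31: `rg 'DatumBUY|cubeRowsGDirCY_at_member'` over `Literature/` + `Summits/` = ∅): dag-n06-d ✓`B9CubeDirInverseBondCMemberRowsAtRecordY`
(the bundle, `cubeRowsGDirCY_of_cutDatum` — USED), ✓`B9Cor36GpDirMemberBlocksAtRecordY` (`Datum36UY`, the site-letter pattern), F3 ∕ F5 (USED).
-/

noncomputable section

namespace Literature.MathematicalPhysics.QuantumFieldTheory.Balaban1983to89.B9Cor36GDirKnitRowsAtMemberY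

open B6RandomWalk (HasMajorant hasMajorant_mono Ineq261)
open B9Thm34Ext (toB6)
open B9Eq352DivFormLetters (conj)
open B9Eq39Adjoint (fluct covD)
open B6KLevelCensusIndexV1 (KIdx kGeo)
open B6Cover236MultiLevelBlocks (cubes)
open B6GlobalChartV1 (PV boxEquiv)
open B9BackgroundsKLevelV1 (shiftsV1)
open B9Eq360DeltaPrimeAY (AfldY)
open B9Eq337CutFieldDirY (cutCfgS)
open B9CubeLettersOpsL0 (levCubeY)
open B9CubeLettersBondOpsL0 (BlkCubeY)
open B9CubeGeometryInputs (geoCK geoCK_len_pos geoCK_dist_axioms RM1 N1 exists_h261_geoCK)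
open B9Cor35GCubeInputsAtOne (blkBK)
open B9Cor35GpAtCubeLetters (hasMajorant_weaken)
open B9Cor35GpDirInputsAtOne (dirDomY)
open B9Cor35GDirInputsAtOne (GiK mDirC geoDirBI domDirBI admDirBI GDirBFam)
open B9Cor35GDirKnitInputsAtOne (TKnitCY)
open B9Cor36GpDirMemberBlocksAtRecordY (collarS2Y)
open B9Cor36GDirCutWindows (unitaryLike_cutCfgS_of_unitary)
open B9Cor36GDirKnitEntriesAtCutField (gDir_knit_entries_at_cutField gDir_knit_entries_at_cutFieldU)
open B9CubeDirInverseBondCMemberRowsAtRecordY (CubeRowsGDirCY cubeRowsGDirCY_of_cutDatum)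
open B9BondReadDomainsPinY (nearAPinCY)
open B9PinMembersKLevelV1 (MemberY)
open B9Thm39ReadingCoords (coordBound39 abs_repr_le)
open B9CoReadingCoordsTranspose (TrIdx trBasis)
open B9CoReadingCoords (cdsBₗ)
open B9C2FormBoxRegimeY (Kpl)
open B7Prop5CplxLevels (epsCplx tauCplx)
open B7Prop2Explicit (unitaryUnits C0 c2')
open B7Prop3Flat (c3)
open Node00 (SiteY FBondY CfgY GaugeY toKT shiftY gaugeY)
open Node00.OpsYCubeDirInverseBond (bondsOverY)
open scoped Matrix Matrix.Norms.L2Operator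

variable {d ℓ : ℕ} {hd : 1 ≤ d + 1} {hL : Odd (ℓ + 1) ∧ 1 < ℓ + 1} {b₀ b₁ : ℝ} {N : ℕ}

/-! ## §1  The (3.35) bond datum of `Ω₀(□)` at `U` (displayed by the heads) -/

section Datum

/-- ★ **THE (3.35) BOND DATUM OF `Ω₀(□)` AT `U`** (the bond twin of dag-n06-d's ✓`Datum36UY`): a unitary gauge `u`, a potential `A`, a cut set `T` containing `Ω₀(□)` and the
one-layer thickening of the pinned reading set `nearAPinCY □ Ω₀(□)` of the letter of record, a box `Q ⊇ chart⁻¹T` with `Uᵘ = e^{iηA}` on its bonds and `‖A‖ ≤ Cξ⁻¹`,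
`‖η⁻¹∂A‖ ≤ Cξ⁻²` there, a datum scale `η ≤ ξ`, `1 ≤ Λ`, `L^{n+1}η ≤ Λξ`, the sizes `2CΛ² ≤ a₁`, `3·2CΛ² ≤ ϱ′`, and p06's knit-leg window numerics at `α₀′` and `2CΛ²`
(print: `□̃` a cube of the (3.35) class with `Ω₀(□) ⊂ □⁵ ⊂ □̃`, Cor. 3.6's «Ω′₀ ⊂ □»; LOCATED-32: displayed, not supplied by the record's class cubes as such).
[cite: Balaban1985BackgroundPropagators, (3.35) p.396, Cor. 3.6 p.408 l.1–14, p.408 («□⁵ is contained in one of the cubes for which this condition holds»), p.409 l.1–5] -/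
def DatumBWit (i : KIdx d ℓ hd hL b₀ b₁) (c : ↥(cubes (toKT i).D.toDomains)) (U : CfgY (Matrix (Fin N) (Fin N) ℂ) i) (a₁ α₀' ϱ' : ℝ)
    (u : GaugeY (Matrix (Fin N) (Fin N) ℂ) i) (A : AfldY (Matrix (Fin N) (Fin N) ℂ) i) (Q : Set (Site (PV d ℓ i.m i.K hd hL) 0)) (T : Finset (SiteY i)) (C ξ Λ : ℝ) : Prop :=
  (∀ z, u z ∈ unitaryUnits (Matrix (Fin N) (Fin N) ℂ)) ∧
    0 ≤ C ∧ (kGeo i).eta ≤ ξ ∧ 1 ≤ Λ ∧ LatticeNorms.scaleLen ((ℓ : ℝ) + 1) (kGeo i).eta (c.1.1 + 1) ≤ Λ * ξ ∧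
    (∀ z ∈ dirDomY i c, z ∈ T) ∧
    (∀ z ∈ nearAPinCY i c (dirDomY i c), ∀ μ : Fin (d + 1), z ∈ T ∧ shiftY i μ z ∈ T ∧ (shiftY i μ).symm z ∈ T) ∧
    (∀ z ∈ T, (boxEquiv i.hN).symm z ∈ Q) ∧
    (∀ (κ : Fin (d + 1)) (x : Site (PV d ℓ i.m i.K hd hL) 0), x ∈ Q → x.shift κ ∈ Q → gaugeY i u U κ x = fluct (kGeo i).eta A κ x) ∧
    (∀ κ, ∀ x ∈ Q, ‖A κ x‖ ≤ C * ξ⁻¹) ∧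
    (∀ μ ν, ∀ x ∈ Q, ‖(((kGeo i).eta : ℂ)⁻¹) • covD (shiftsV1 (PV d ℓ i.m i.K hd hL)) (fun _ _ => (1 : (Matrix (Fin N) (Fin N) ℂ)ˣ)) μ (A ν) x‖ ≤ C * (ξ ^ 2)⁻¹) ∧
    2 * C * Λ ^ 2 ≤ a₁ ∧ 3 * (2 * C * Λ ^ 2) ≤ ϱ' ∧
    Real.exp (4 * (800 * (((d + 1 : ℕ) : ℝ) + 1) ^ 2 * (((d + 1 : ℕ) : ℝ) + 4)) * α₀') * (1 + 8 * (131072 * (((d + 1 : ℕ) : ℝ) + 1) ^ 2) * (2 * C * Λ ^ 2)) ≤ 2 ∧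
    2 * (2 * C * Λ ^ 2) ≤ c3 (d + 1) (ℓ + 1) ∧ 4096 * ((d + 1 : ℕ) : ℝ) * (2 * C * Λ ^ 2) ≤ 1

/-- ★ **THE (3.35) BOND DATUM OF `Ω₀(□)` AT `U`, EXISTENTIALLY PACKAGED** (the row the heads display per `(x, U, □)`; LOCATED-32).
[cite: Balaban1985BackgroundPropagators, (3.35) p.396, Cor. 3.6 p.408 l.1–14, p.409 l.1–5] -/
def DatumBUY (i : KIdx d ℓ hd hL b₀ b₁) (c : ↥(cubes (toKT i).D.toDomains)) (U : CfgY (Matrix (Fin N) (Fin N) ℂ) i) (a₁ α₀' ϱ' : ℝ) : Prop :=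
  ∃ (u : GaugeY (Matrix (Fin N) (Fin N) ℂ) i) (A : AfldY (Matrix (Fin N) (Fin N) ℂ) i) (Q : Set (Site (PV d ℓ i.m i.K hd hL) 0)) (T : Finset (SiteY i)) (C ξ Λ : ℝ),
    DatumBWit i c U a₁ α₀' ϱ' u A Q T C ξ Λ

end Datum

/-! ## §2  ★★★ The bundle at every member, every unitary-valued `U`, every cube -/

section Main

variable [Nonempty (Fin N)] {Mstar : ℕ}

/-- ★★★ **THE α₀-UNIFORM EDITION OF `cubeRowsGDirCY_at_member`** (dag-n06-d g35, LOCATED-37): dag-n06-d's bundle `CubeRowsGDirCY x.toKIdx □ U dB (B₂ + B) δ (9∕5000)`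
at every `(x, U, □)` from the bond datum, the socket, the named fact and the flat right half — with the auxiliary knit-leg parameter `α₀` (`0 < α₀`, `0 ≤ Mα₀`,
`K_pl(Mα₀)L⁴ < α₀′`) quantified PER MEMBER inside the universal block, so that `(δ, B, M₀, T₀, N₀, dB, a₁)` are chosen before it: the heads offer only a
member-dependent `α₀` (`c·M·α₀ ≤ a₁` with `M = L·M_h` unbounded over the record), and their x-free rows `(c_b Σ‖b‖)²·((B₂+B)·c₁) ≤ B_c`, `δ₀ ≤ (1 − 9∕5000)δ` need
α₀-free constants (named by `dite` downstream).  The proof is the original one with `α₀ hα₀` introduced after the witnesses, over ✓`gDir_knit_entries_at_cutFieldU`;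
`cubeRowsGDirCY_at_member` below is now its corollary.
[cite: Balaban1985BackgroundPropagators, Cor. 3.6 p.408 l.1–14, Cor. 3.5 p.407, Thm 3.3 p.399, Thm 3.1 (3.42) p.397, (3.35) p.396, p.409 l.1–5, p.410 l.14–15; Balaban1984PropagatorsII, Lemma 2.1 (2.61) p.234, (2.51) p.232, Prop. 2.6 (2.136) p.247, p.248 l.4–5] -/
theorem cubeRowsGDirCY_at_memberU
    (h26 : B6.Prop26DirichletPrinted (geoDirBI (d := d) (ℓ := ℓ) (hd := hd) (hL := hL) (b₀ := b₀) (b₁ := b₁)) domDirBI admDirBI GDirBFam)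
    (hℓ : 1 ≤ ℓ) (hb₀ : 0 < b₀) (hb₁ : b₀ ≤ b₁)
    {α₀' ϱ' ϱ : ℝ} (hα' : 0 < α₀') (hα3 : C0 (d + 1) * α₀' ≤ 1 / 3) (hα8 : 8 * α₀' ≤ c2' (d + 1) (ℓ + 1))
    (hϱ' : 0 < ϱ') (hϱ : 0 < ϱ)
    (hsmall' : Real.exp (4 * (800 * (((d + 1 : ℕ) : ℝ) + 1) ^ 2 * (((d + 1 : ℕ) : ℝ) + 4)) * α₀') * (1 + 8 * (131072 * (((d + 1 : ℕ) : ℝ) + 1) ^ 2) * ϱ') ≤ 2)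
    (hc₃' : 2 * ϱ' ≤ c3 (d + 1) (ℓ + 1)) (hϱ'1 : 409600 * (((d + 1 : ℕ) : ℝ) + 1) ^ 2 * ϱ' ≤ 1)
    (hE : epsCplx (d + 1) (ℓ + 1) ϱ' 0 ≤ 1 / 16)
    (hdX : ((d + 1 : ℕ) : ℝ) * (epsCplx (d + 1) (ℓ + 1) ϱ' 0 + tauCplx (d + 1) (ℓ + 1) α₀' 0 ϱ' 0) ≤ 1 / 16)
    (hsmallJ : Real.exp (4480 * (((d + 1 : ℕ) : ℝ) + 1) ^ 2 * (((d + 1 : ℕ) : ℝ) + 4) * α₀' + 240000 * (((d + 1 : ℕ) : ℝ) + 1) ^ 3 * ϱ') *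
      (1 + 8 * (2097152 * (((d + 1 : ℕ) : ℝ) + 1) ^ 2) * ϱ) ≤ 2)
    (hc₃J : 2 * ϱ ≤ c3 (d + 1) (ℓ + 1) / 4) :
    ∃ δ B M₀ T₀ : ℝ, ∃ N₀ dB : ℕ, 0 < δ ∧ 0 ≤ B ∧ ∃ a₁ : ℝ, 0 < a₁ ∧
    ∀ (x : MemberY d ℓ hd hL b₀ b₁ Mstar),
      M₀ ≤ ((ℓ : ℝ) + 1) * (toKT x.toKIdx).Mh → N₀ + 1 ≤ (toKT x.toKIdx).R * ((ℓ + 1) * (toKT x.toKIdx).Mh) → T₀ ≤ RM1 x.toKIdx →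
    ∀ α₀ : ℝ, 0 < α₀ → 0 ≤ (kGeo x.toKIdx).M * α₀ → Kpl x.toKIdx ((kGeo x.toKIdx).M * α₀) * (kGeo x.toKIdx).L ^ 4 < α₀' →
    ∀ (U : CfgY (Matrix (Fin N) (Fin N) ℂ) x.toKIdx), (∀ μ z, U μ z ∈ unitaryUnits (Matrix (Fin N) (Fin N) ℂ)) →
      (∀ c' : ↥(cubes x.toKIdx.D.toDomains), ∃ KB : Matrix (FBondY x.toKIdx) (FBondY x.toKIdx) ℝ,
        (mDirC x.toKIdx c').submatrix (fun v : ↥(bondsOverY x.toKIdx (dirDomY x.toKIdx c')) => (v : FBondY x.toKIdx))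
            (fun v : ↥(bondsOverY x.toKIdx (dirDomY x.toKIdx c')) => (v : FBondY x.toKIdx)) *
          KB.submatrix (fun v : ↥(bondsOverY x.toKIdx (dirDomY x.toKIdx c')) => (v : FBondY x.toKIdx))
            (fun v : ↥(bondsOverY x.toKIdx (dirDomY x.toKIdx c')) => (v : FBondY x.toKIdx)) = 1) →
    ∀ (B₂ : ℝ), 0 ≤ B₂ →
      (∀ c' : ↥(cubes x.toKIdx.D.toDomains), DatumBUY x.toKIdx c' U a₁ α₀' ϱ') →
      (∀ (c' : ↥(cubes x.toKIdx.D.toDomains)) (u : GaugeY (Matrix (Fin N) (Fin N) ℂ) x.toKIdx) (A : AfldY (Matrix (Fin N) (Fin N) ℂ) x.toKIdx)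
          (Q : Set (Site (PV d ℓ x.toKIdx.m x.toKIdx.K hd hL) 0)) (T : Finset (SiteY x.toKIdx)) (C ξ Λ : ℝ),
          DatumBWit x.toKIdx c' U a₁ α₀' ϱ' u A Q T C ξ Λ → ∀ (Rr : ℝ) (Hc : Prop) (ν : Fin (d + 1)),
            HasMajorant (g := toB6 (geoCK x.toKIdx c') Rr Hc) (blkBK x.toKIdx c')
              (GiK (trBasis N) x.toKIdx (TKnitCY x.toKIdx c' (cutCfgS x.toKIdx T (kGeo x.toKIdx).eta A)) (bondsOverY x.toKIdx (dirDomY x.toKIdx c')) *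
                conj (trBasis N) (cdsBₗ x.toKIdx (fun _ _ => (1 : (Matrix (Fin N) (Fin N) ℂ)ˣ)) ν))
              (fun a a' => B₂ * (geoCK x.toKIdx c').len a * Real.exp (-(δ * (geoCK x.toKIdx c').dist a a')))) →
      ∀ c' : ↥(cubes x.toKIdx.D.toDomains), CubeRowsGDirCY x.toKIdx c' U dB (B₂ + B) δ (9 / 5000) := by
  classical
  have hM₂ : 0 ≤ coordBound39 (trBasis N) := norm_nonneg _
  obtain ⟨δ, Bf, M₀, T₀, N₀, hδ, hBf, a₁, ha₁, h⟩ := gDir_knit_entries_at_cutFieldU (d := d) (ℓ := ℓ) (hd := hd) (hL := hL) (b₀ := b₀) (b₁ := b₁) (trBasis N) h26 hℓ hb₀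
    hb₁ (coordBound39 (trBasis N)) hM₂ (abs_repr_le (trBasis N)) hα' hα3 hα8 hϱ' hϱ hsmall' hc₃' hϱ'1 hE hdX hsmallJ hc₃J
  obtain ⟨dB, h261⟩ := exists_h261_geoCK d ℓ hδ
  refine ⟨δ, Bf, M₀, T₀, max N₀ (N1 d ℓ (9 / 5000 * δ)), dB, hδ, hBf, a₁, ha₁, ?_⟩
  intro x hM hN hT α₀ hα₀ hMα hKpl U hUu hKB B₂ hB₂ hDat hR c'
  have hN₀ : N₀ + 1 ≤ (toKT x.toKIdx).R * ((ℓ + 1) * (toKT x.toKIdx).Mh) := le_trans (Nat.succ_le_succ (le_max_left _ _)) hN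
  have hN₁ : N1 d ℓ (9 / 5000 * δ) + 1 ≤ (toKT x.toKIdx).R * ((ℓ + 1) * (toKT x.toKIdx).Mh) := le_trans (Nat.succ_le_succ (le_max_right _ _)) hN
  obtain ⟨u, A, Q, T, C, ξ, Λ, hW⟩ := hDat c'
  obtain ⟨hu, hC, hξ, hΛ, hΛξ, hTS, hTn, hQT, hgA, hA, hdA, hα₁, hα₁ϱ, hsmall, hc₃, hsm⟩ := hW
  obtain ⟨KB, hKB'⟩ := hKB c'
  have hα4' : 4 * α₀' ≤ c2' (d + 1) (ℓ + 1) := by linarith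
  have hU := unitaryLike_cutCfgS_of_unitary x.toKIdx (T := T) (η := (kGeo x.toKIdx).eta) (A := A) hu hUu hQT hgA
  obtain ⟨hunit, E0, E1, -, E3, hE2⟩ := h x.toKIdx c' 1 True hM hN₀ hT α₀ hα₀ hMα hKpl KB hKB' T A Q C ξ Λ hC hξ hΛ hΛξ hTS hQT hA hdA (collarS2Y x.toKIdx c') hα₁ hα₁ϱ
    hα4' hsmall hc₃ hsm hU
  have h261' : Ineq261 dB (toB6 (geoCK x.toKIdx c') 1 True) δ (9 / 5000) := h261 x.toKIdx c' 1 True hN₁ (9 / 5000) le_rfl (by norm_num)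
  have hlen0 : ∀ a : BlkCubeY x.toKIdx c', 0 ≤ (geoCK x.toKIdx c').len a := fun a => (geoCK_len_pos x.toKIdx c' a).le
  have hlen2 : ∀ a : BlkCubeY x.toKIdx c', 0 ≤ (geoCK x.toKIdx c').len a ^ 2 := fun a => sq_nonneg _
  have hBB : Bf ≤ B₂ + Bf := by linarith
  have hBB0 : 0 ≤ B₂ + Bf := by linarith
  refine cubeRowsGDirCY_of_cutDatum x c' hu hTn hQT hgA 1 True h261' hunit ?_ ?_ ?_ ?_
  · exact hasMajorant_weaken x.toKIdx c' 1 True _ hlen2 hBB hBB0 le_rfl E0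
  · exact fun ν => hasMajorant_weaken x.toKIdx c' 1 True _ hlen0 hBB hBB0 le_rfl (E1 ν)
  · intro ν
    exact hE2 ν B₂ δ hB₂ hδ.le le_rfl (hR c' u A Q T C ξ Λ ⟨hu, hC, hξ, hΛ, hΛξ, hTS, hTn, hQT, hgA, hA, hdA, hα₁, hα₁ϱ, hsmall, hc₃, hsm⟩ 1 True ν)
  · refine hasMajorant_mono (g := toB6 (geoCK x.toKIdx c') 1 True) _ E3 fun a a' => ?_
    have hx : 0 ≤ Real.exp (-(δ * (geoCK x.toKIdx c').dist a a')) := Real.exp_nonneg _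
    nlinarith

/-- ★★★ **dag-n06-d's BUNDLE `CubeRowsGDirCY` INHABITED AT EVERY `(x, U, □)` FROM THE BOND DATUM, THE SOCKET, THE NAMED FACT AND THE FLAT RIGHT HALF** (Cor. 3.6 for the
Dirichlet bond letter of record, «all the results of these theorems are gauge invariant»): under `h26 : B6.Prop26DirichletPrinted` (by name) and the x-free knit-engine
numerics there are `δ > 0`, `B ≥ 0`, `dB`, thresholds `M₀, T₀, N₀` and `a₁ > 0` such that for every member `x` above the thresholds, every unitary-valued `U` carrying a
`DatumBUY x.toKIdx □ U a₁ α₀′ ϱ′` and a real inverse of the compression of `mDirC x.toKIdx □` at every cover cube `□`, and the displayed flat right half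
`G(Ṽ_□)·conj(∇*_{1,ν}) ≺ B₂·Lⁿη·e^{−δd}` at the cut fields `Ṽ_□` of the data: `CubeRowsGDirCY x.toKIdx □ U dB (B₂ + B) δ (9∕5000)` at every `□`.
[cite: Balaban1985BackgroundPropagators, Cor. 3.6 p.408 l.1–14, Cor. 3.5 p.407, Thm 3.3 p.399, Thm 3.1 (3.42) p.397, (3.35) p.396, p.409 l.1–5, p.410 l.14–15; Balaban1984PropagatorsII, Lemma 2.1 (2.61) p.234, (2.51) p.232, Prop. 2.6 (2.136) p.247, p.248 l.4–5] -/
theorem cubeRowsGDirCY_at_member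
    (h26 : B6.Prop26DirichletPrinted (geoDirBI (d := d) (ℓ := ℓ) (hd := hd) (hL := hL) (b₀ := b₀) (b₁ := b₁)) domDirBI admDirBI GDirBFam)
    (hℓ : 1 ≤ ℓ) (hb₀ : 0 < b₀) (hb₁ : b₀ ≤ b₁)
    {α₀ α₀' ϱ' ϱ : ℝ} (hα₀ : 0 < α₀) (hα' : 0 < α₀') (hα3 : C0 (d + 1) * α₀' ≤ 1 / 3) (hα8 : 8 * α₀' ≤ c2' (d + 1) (ℓ + 1))
    (hϱ' : 0 < ϱ') (hϱ : 0 < ϱ)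
    (hsmall' : Real.exp (4 * (800 * (((d + 1 : ℕ) : ℝ) + 1) ^ 2 * (((d + 1 : ℕ) : ℝ) + 4)) * α₀') * (1 + 8 * (131072 * (((d + 1 : ℕ) : ℝ) + 1) ^ 2) * ϱ') ≤ 2)
    (hc₃' : 2 * ϱ' ≤ c3 (d + 1) (ℓ + 1)) (hϱ'1 : 409600 * (((d + 1 : ℕ) : ℝ) + 1) ^ 2 * ϱ' ≤ 1)
    (hE : epsCplx (d + 1) (ℓ + 1) ϱ' 0 ≤ 1 / 16)
    (hdX : ((d + 1 : ℕ) : ℝ) * (epsCplx (d + 1) (ℓ + 1) ϱ' 0 + tauCplx (d + 1) (ℓ + 1) α₀' 0 ϱ' 0) ≤ 1 / 16)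
    (hsmallJ : Real.exp (4480 * (((d + 1 : ℕ) : ℝ) + 1) ^ 2 * (((d + 1 : ℕ) : ℝ) + 4) * α₀' + 240000 * (((d + 1 : ℕ) : ℝ) + 1) ^ 3 * ϱ') *
      (1 + 8 * (2097152 * (((d + 1 : ℕ) : ℝ) + 1) ^ 2) * ϱ) ≤ 2)
    (hc₃J : 2 * ϱ ≤ c3 (d + 1) (ℓ + 1) / 4) :
    ∃ δ B M₀ T₀ : ℝ, ∃ N₀ dB : ℕ, 0 < δ ∧ 0 ≤ B ∧ ∃ a₁ : ℝ, 0 < a₁ ∧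
    ∀ (x : MemberY d ℓ hd hL b₀ b₁ Mstar),
      M₀ ≤ ((ℓ : ℝ) + 1) * (toKT x.toKIdx).Mh → N₀ + 1 ≤ (toKT x.toKIdx).R * ((ℓ + 1) * (toKT x.toKIdx).Mh) → T₀ ≤ RM1 x.toKIdx →
      0 ≤ (kGeo x.toKIdx).M * α₀ → Kpl x.toKIdx ((kGeo x.toKIdx).M * α₀) * (kGeo x.toKIdx).L ^ 4 < α₀' →
    ∀ (U : CfgY (Matrix (Fin N) (Fin N) ℂ) x.toKIdx), (∀ μ z, U μ z ∈ unitaryUnits (Matrix (Fin N) (Fin N) ℂ)) →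
      (∀ c' : ↥(cubes x.toKIdx.D.toDomains), ∃ KB : Matrix (FBondY x.toKIdx) (FBondY x.toKIdx) ℝ,
        (mDirC x.toKIdx c').submatrix (fun v : ↥(bondsOverY x.toKIdx (dirDomY x.toKIdx c')) => (v : FBondY x.toKIdx))
            (fun v : ↥(bondsOverY x.toKIdx (dirDomY x.toKIdx c')) => (v : FBondY x.toKIdx)) *
          KB.submatrix (fun v : ↥(bondsOverY x.toKIdx (dirDomY x.toKIdx c')) => (v : FBondY x.toKIdx))
            (fun v : ↥(bondsOverY x.toKIdx (dirDomY x.toKIdx c')) => (v : FBondY x.toKIdx)) = 1) →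
    ∀ (B₂ : ℝ), 0 ≤ B₂ →
      (∀ c' : ↥(cubes x.toKIdx.D.toDomains), DatumBUY x.toKIdx c' U a₁ α₀' ϱ') →
      (∀ (c' : ↥(cubes x.toKIdx.D.toDomains)) (u : GaugeY (Matrix (Fin N) (Fin N) ℂ) x.toKIdx) (A : AfldY (Matrix (Fin N) (Fin N) ℂ) x.toKIdx)
          (Q : Set (Site (PV d ℓ x.toKIdx.m x.toKIdx.K hd hL) 0)) (T : Finset (SiteY x.toKIdx)) (C ξ Λ : ℝ),
          DatumBWit x.toKIdx c' U a₁ α₀' ϱ' u A Q T C ξ Λ → ∀ (Rr : ℝ) (Hc : Prop) (ν : Fin (d + 1)),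
            HasMajorant (g := toB6 (geoCK x.toKIdx c') Rr Hc) (blkBK x.toKIdx c')
              (GiK (trBasis N) x.toKIdx (TKnitCY x.toKIdx c' (cutCfgS x.toKIdx T (kGeo x.toKIdx).eta A)) (bondsOverY x.toKIdx (dirDomY x.toKIdx c')) *
                conj (trBasis N) (cdsBₗ x.toKIdx (fun _ _ => (1 : (Matrix (Fin N) (Fin N) ℂ)ˣ)) ν))
              (fun a a' => B₂ * (geoCK x.toKIdx c').len a * Real.exp (-(δ * (geoCK x.toKIdx c').dist a a')))) →
      ∀ c' : ↥(cubes x.toKIdx.D.toDomains), CubeRowsGDirCY x.toKIdx c' U dB (B₂ + B) δ (9 / 5000) := by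
  obtain ⟨δ, B, M₀, T₀, N₀, dB, hδ, hB, a₁, ha₁, h⟩ := cubeRowsGDirCY_at_memberU (N := N) (Mstar := Mstar) h26 hℓ hb₀ hb₁ hα' hα3 hα8 hϱ' hϱ hsmall' hc₃' hϱ'1 hE
    hdX hsmallJ hc₃J
  exact ⟨δ, B, M₀, T₀, N₀, dB, hδ, hB, a₁, ha₁, fun x hM hN hT hMα hKpl => h x hM hN hT α₀ hα₀ hMα hKpl⟩

end Main

end Literature.MathematicalPhysics.QuantumFieldTheory.Balaban1983to89.B9Cor36GDirKnitRowsAtMemberY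

end
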